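import Mathlib
import HarnessLib
import Summits.NavierStokesRegularity.NavierStokesRegularity.Theorems.PoloidalWindowDoorLrcModEntireCurvedTowerSheet
import Summits.NavierStokesRegularity.NavierStokesRegularity.Theorems.PoloidalWindowDoorLrcModEntireCurvedTowerElimHeight
import Summits.NavierStokesRegularity.NavierStokesRegularity.Theorems.PoloidalWindowDoorLrcModEntirePoleArgumentUniform
import Summits.NavierStokesRegularity.NavierStokesRegularity.Theorems.PoloidalWindowDoorLrcModEntireCurvedWebTools

/-!
# Route `PoloidalWindowDoor`, item `LrcModEntire` (stmt-NavierStokesRegularity-20428), cell (Q4-curved) of the (TH) column —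
# ★★★ THE TOWER KILLS THE CURVATURE: a curved parallel web sheet of the (TH) column over an `s`-interval has `k′(s₀) = 0`

Cell ns-regularity-ideate, helper seat ns-k2-port-2 g9 (assembly owner) under the LEAD of item 20428 (ns-poloidal-K2-p3 g17 / successor g18).  Memo
`Cruxes/LrcModEntire/TOWER-CLOSES-port2g9.md` §A–§E, `T2B-g17.md` §6/§13/§14.  `--supports stmt-NavierStokesRegularity-20428 --as helper`.

This is the class-level composition of the whole §E chain at ONE base point: B-SPEEDc/B-JETc/B-CRc (local) ⇒ (6b) and (1′)(2′) on `S × I` (`…CurvedTowerSheet`) ⇒ the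
jets (`…CurvedTowerSheetForm.plane_jets/weighted_jets`) ⇒ the first integral (P) at the heights `m = d(z)` (`…CurvedTowerElimHeight.tower_first_integral_height`) ⇒
`k′(s₀) = 0` (`…PoleArgumentUniform.curvature_deriv_eq_zero_of_first_integral`, J1/J4 over the LEAD's B-POLE).

★★★ `tower_kills_curvature` — HYPOTHESES (all supplied, at a small non-sonic base time `t = −1+τ₁`, by ns-poloidal-K2-p2 g18's `…FermiTimeWebAt.curved_timeWeb_at` + the
END′ data + `…CurvedTimeSplitLocal.curved_webSpeed_split_on`): the class profile `U` with the (TH) slab law (slope `μ`, `C³` jointly, `μ(t,·) ∈ C^∞` and `≠ 1` on the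
window); a `C^∞` unit-speed planar branch `Γ` with Frenet curvature `k ∈ C²`; open `S ∋ s₀` and an open height window `I ⊂ (−ρ,ρ)`, `I` non-empty; a `C^∞` offset `d` on `I` with
`d′ ≠ 0` (non-vertical sheet) and Fermi factor `1 − k(s)d(z) ≠ 0`; web criticality of `θ = U₂(t,·)` at `W(s,z) = Γ(s) + d(z)JΓ′(s) + z e₂` on `S × I`; the ridge law
`D²θ(W)[JΓ′,JΓ′] = −κ(z)` with `κ ∈ C^∞(I)`, `κ ≠ 0`; the value `U₂(t,W(s,z)) = R_v(z)` (`R_v ∈ C^∞(I)`); the web speed `V` with the kinematic hypothesis `hkin` at every sheet point and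
the split `V(s,z) = α(s) + β(z)` (`α ∈ C²(S)`, `β ∈ C^∞(I)`); NON-SONIC heights `d′(z)² + μ(t,z) ≠ 0` on `I`.  CONCLUSION: **`deriv k s₀ = 0`**.
(Apply at every `s₀`: `k` is constant; a graph over the whole line with constant curvature is a line (J2, `…PlanarCurveRigidity`), `k ≡ 0`, and K2-p2's J3 pins the base web —
contradicting END′'s `hunpin`.  That assembly is the next file.)

WHAT THIS IS NOT: not a claim about Navier–Stokes regularity; a class-level identity chain for the research slots `stub_Q4curvedAperiodic` / `stub_Q4sonicLineNegIsolated`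
of registry twist_split v14; no stub is closed here; items 20428 / 19708 / 27893 OPEN.
-/

noncomputable section

set_option linter.dupNamespace false
set_option linter.style.longLine false

namespace Summit.NavierStokesRegularity.NavierStokesRegularity.Theorems.PoloidalWindowDoorLrcModEntireCurvedTowerKill

open Set Function Filter Topology Metric
open scoped RealInnerProductSpace InnerProductSpace ContDiff
open Literature.Analysis Literature.Analysis.FluidPDE Literature.Analysis.UnboundedOperators
open Summit.NavierStokesRegularity.NavierStokesRegularity.Theorems
open Summit.NavierStokesRegularity.NavierStokesRegularity.Theorems.LocalSineTubeDoorProfileAlignedWindowRigidityAncient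
open Summit.NavierStokesRegularity.NavierStokesRegularity.Theorems.PoloidalWindowDoorPoloidalWindowRigidityWindow
open Summit.NavierStokesRegularity.NavierStokesRegularity.Theorems.PoloidalWindowDoorLrcModEntireSheetFlattenTools
open Summit.NavierStokesRegularity.NavierStokesRegularity.Theorems.PoloidalWindowDoorLrcModEntireRidgeGlobalBranchFrame
open Summit.NavierStokesRegularity.NavierStokesRegularity.Theorems.PoloidalWindowDoorLrcModEntirePlanarCurveRigidity
open Summit.NavierStokesRegularity.NavierStokesRegularity.Theorems.PoloidalWindowDoorLrcModEntireCurvedWebHuygens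
open Summit.NavierStokesRegularity.NavierStokesRegularity.Theorems.PoloidalWindowDoorLrcModEntireCurvedWebTools
open Summit.NavierStokesRegularity.NavierStokesRegularity.Theorems.PoloidalWindowDoorLrcModEntireCurvedTowerSheetForm
open Summit.NavierStokesRegularity.NavierStokesRegularity.Theorems.PoloidalWindowDoorLrcModEntireCurvedTowerSheet
open Summit.NavierStokesRegularity.NavierStokesRegularity.Theorems.PoloidalWindowDoorLrcModEntireCurvedTowerElim
open Summit.NavierStokesRegularity.NavierStokesRegularity.Theorems.PoloidalWindowDoorLrcModEntireCurvedTowerElimHeight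
open Summit.NavierStokesRegularity.NavierStokesRegularity.Theorems.PoloidalWindowDoorLrcModEntirePoleArgumentUniform
open Summit.NavierStokesRegularity.NavierStokesRegularity.Theorems.PoloidalWindowDoorLrcModEntireRidgeClassConstants
open Summit.NavierStokesRegularity.NavierStokesRegularity.Theorems.PoloidalWindowDoorLrcModEntireSonicSheetTrig (hasDerivAt_slice_fst hasDerivAt_slice_snd)

variable {C : ℝ} {U : ℝ → EuclideanSpace ℝ (Fin 3) → EuclideanSpace ℝ (Fin 3)} {μ : ℝ → ℝ → ℝ} {ρ τ : ℝ} {S I : Set ℝ}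
  {d k κ α β Rv : ℝ → ℝ} {V : ℝ → ℝ → ℝ} {Γ : ℝ → EuclideanSpace ℝ (Fin 3)} {σ s₀ : ℝ}

/-- ★★★ **THE TOWER KILLS THE CURVATURE.**  See the module docstring. -/
theorem tower_kills_curvature
    (hrate : HasTypeITimeDecay C U) (hcont : ContinuousOn (uncurry U) (Iio (0 : ℝ) ×ˢ univ))
    (hmild : ∀ s t : ℝ, s < t → t < 0 → ∀ x, U t x = heatExtension (U s) (t - s) x - oseenDuhamel 1 s U U t x)
    (hdiv : ∀ t < 0, VectorCalculus.IsDivFree (U t))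
    (hpol : ∀ s < 0, ∀ y, ⟪curl (U s) y, EuclideanSpace.single 2 1⟫_ℝ = 0)
    (hμ3 : ContDiff ℝ 3 (uncurry μ))
    (hslabU : ∀ t : ℝ, |t + 1| < ρ → ∀ x : EuclideanSpace ℝ (Fin 3), |x 2| < ρ → ∀ b : Fin 3, b ≠ 2 →
      fderiv ℝ (U t) x (EuclideanSpace.single 2 1) b = μ t (x 2) * fderiv ℝ (U t) x (EuclideanSpace.single b 1) 2)
    (hτ : |τ| < 1 / 2) (hτρ : |τ| < ρ)
    (hΓ : ContDiff ℝ ∞ Γ) (hpl : ∀ s, Γ s 2 = 0) (hun : ∀ s, ‖deriv Γ s‖ = 1)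
    (hk : ∀ s, deriv (deriv Γ) s = k s • rotJ (deriv Γ s)) (hkC : ContDiff ℝ 2 k)
    (hS : IsOpen S) (hs₀ : s₀ ∈ S) (hI : IsOpen I) (hIne : I.Nonempty) (hIρ : ∀ z ∈ I, |z| < ρ)
    (hd : ContDiffOn ℝ ∞ d I) (hd0 : ∀ z ∈ I, deriv d z ≠ 0)
    (hJ : ∀ s ∈ S, ∀ z ∈ I, 1 - k s * d z ≠ 0)
    (hν : ∀ s ∈ S, ∀ z ∈ I, fderiv ℝ (fun y => U (-1 + τ) y 2) (Γ s + d z • rotJ (deriv Γ s) + z • e2) (rotJ (deriv Γ s)) = 0)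
    (hT : ∀ s ∈ S, ∀ z ∈ I, fderiv ℝ (fun y => U (-1 + τ) y 2) (Γ s + d z • rotJ (deriv Γ s) + z • e2) (deriv Γ s) = 0)
    (hκ : ContDiffOn ℝ ∞ κ I) (hκ0 : ∀ z ∈ I, κ z ≠ 0)
    (hridge : ∀ s ∈ S, ∀ z ∈ I,
      fderiv ℝ (fderiv ℝ (fun y => U (-1 + τ) y 2)) (Γ s + d z • rotJ (deriv Γ s) + z • e2) (rotJ (deriv Γ s)) (rotJ (deriv Γ s)) = -κ z)
    (hRv : ContDiffOn ℝ ∞ Rv I) (hval : ∀ s ∈ S, ∀ z ∈ I, U (-1 + τ) (Γ s + d z • rotJ (deriv Γ s) + z • e2) 2 = Rv z)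
    (hσ : σ = 1 ∨ σ = -1)
    (hkin : ∀ s ∈ S, ∀ z ∈ I, fderiv ℝ (fderiv ℝ (uncurry fun a y => σ * U (-1 + a) y 2)) (τ, Γ s + d z • rotJ (deriv Γ s) + z • e2)
      ((1 : ℝ), V s z • rotJ (deriv Γ s)) ((0 : ℝ), rotJ (deriv Γ s)) = 0)
    (hsplit : ∀ s ∈ S, ∀ z ∈ I, V s z = α s + β z) (hα : ContDiffOn ℝ 2 α S) (hβ : ContDiffOn ℝ ∞ β I)
    (hQ : ∀ z ∈ I, deriv d z ^ 2 + μ (-1 + τ) z ≠ 0) (hμ1 : ∀ z ∈ I, μ (-1 + τ) z ≠ 1) (hμs : ContDiffOn ℝ ∞ (μ (-1 + τ)) I) :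
    deriv k s₀ = 0 := by
  set t : ℝ := -1 + τ with ht_def
  have ht : t < 0 := by rw [ht_def]; linarith [(abs_lt.1 hτ).2]
  set θ : EuclideanSpace ℝ (Fin 3) → ℝ := fun y => U t y 2 with hθ_def
  /- STEP 0: regularity of the slice, the frame, the web map -/
  have hUan : AnalyticOnNhd ℝ (U t) univ := analyticOnNhd_slice hcont (bdd_of_hasTypeITimeDecay hrate) hmild ht
  have hUC : ContDiff ℝ ∞ (U t) := hUan.contDiff
  have hθC : ContDiff ℝ ∞ θ := (contDiff_piLp_apply (p := 2) (𝕜 := ℝ) (E := fun _ : Fin 3 => ℝ) (i := (2 : Fin 3))).comp hUC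
  have hθd : Differentiable ℝ θ := hθC.differentiable (by simp)
  have hΓ2 : ContDiff ℝ 2 Γ := hΓ.of_le (by norm_cast)
  have hdΓ : ContDiff ℝ ∞ (deriv Γ) := hΓ.deriv'
  have hνC : ContDiff ℝ ∞ (fun s => rotJ (deriv Γ s)) := contDiff_rotJ.comp hdΓ
  -- the web map on `S × I` and the two sheet components
  set W2 : ℝ × ℝ → EuclideanSpace ℝ (Fin 3) := fun q => Γ q.1 + d q.2 • rotJ (deriv Γ q.1) + q.2 • e2 with hW2
  have hW2C : ContDiffOn ℝ ∞ W2 (S ×ˢ I) := by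
    have h1 : ContDiffOn ℝ ∞ (fun q : ℝ × ℝ => Γ q.1) (S ×ˢ I) := (hΓ.comp contDiff_fst).contDiffOn
    have h2 : ContDiffOn ℝ ∞ (fun q : ℝ × ℝ => d q.2) (S ×ˢ I) := hd.comp contDiffOn_snd fun q hq => hq.2
    have h3 : ContDiffOn ℝ ∞ (fun q : ℝ × ℝ => rotJ (deriv Γ q.1)) (S ×ˢ I) := (hνC.comp contDiff_fst).contDiffOn
    have h4 : ContDiffOn ℝ ∞ (fun q : ℝ × ℝ => q.2 • e2) (S ×ˢ I) := (contDiff_snd.smul contDiff_const).contDiffOn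
    exact (h1.add (h2.smul h3)).add h4
  set P2 : ℝ × ℝ → ℝ := fun q => ⟪U t (W2 q), deriv Γ q.1⟫ with hP2
  set H2 : ℝ × ℝ → ℝ := fun q => ⟪U t (W2 q), rotJ (deriv Γ q.1)⟫ with hH2
  have hP2C : ContDiffOn ℝ ∞ P2 (S ×ˢ I) := (hUC.comp_contDiffOn hW2C).inner ℝ (hdΓ.comp contDiff_fst).contDiffOn
  have hH2C : ContDiffOn ℝ ∞ H2 (S ×ˢ I) := (hUC.comp_contDiffOn hW2C).inner ℝ (hνC.comp contDiff_fst).contDiffOn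
  /- STEP 1: the profiles `c, g, t` of (6b) and their smoothness on `I` -/
  have hd1 : ContDiffOn ℝ ∞ (deriv d) I := hd.deriv_of_isOpen hI (m := ∞) (by simp)
  have hd2 : ContDiffOn ℝ ∞ (deriv (deriv d)) I := hd1.deriv_of_isOpen hI (m := ∞) (by simp)
  have hκ1 : ContDiffOn ℝ ∞ (deriv κ) I := hκ.deriv_of_isOpen hI (m := ∞) (by simp)
  have hμz : ContDiffOn ℝ ∞ (deriv (μ t)) I := hμs.deriv_of_isOpen hI (m := ∞) (by simp)
  have hRv1 : ContDiffOn ℝ ∞ (deriv Rv) I := hRv.deriv_of_isOpen hI (m := ∞) (by simp)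
  set c : ℝ → ℝ := fun z => (1 - μ t z) * deriv d z ^ 2 / (deriv d z ^ 2 + μ t z) with hc_def
  set g : ℝ → ℝ := fun z => β z + (1 - μ t z) * (2 * deriv d z * deriv κ z / κ z + deriv (deriv d) z) / (deriv d z ^ 2 + μ t z)
      + deriv d z * Rv z + 2 * deriv (μ t) z * deriv d z / (1 - μ t z) with hg_def
  set tr : ℝ → ℝ := fun z => -(deriv Rv z) with htr_def
  have h1μ : ∀ z ∈ I, 1 - μ t z ≠ 0 := fun z hz => sub_ne_zero.2 (Ne.symm (hμ1 z hz))
  have hcC : ContDiffOn ℝ ∞ c I :=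
    ((contDiffOn_const.sub hμs).mul (hd1.pow 2)).div ((hd1.pow 2).add hμs) hQ
  have hgC : ContDiffOn ℝ ∞ g I := by
    refine ((hβ.add ?_).add (hd1.mul hRv)).add ?_
    · exact ((contDiffOn_const.sub hμs).mul ((((contDiffOn_const.mul hd1).mul hκ1).div hκ hκ0).add hd2)).div ((hd1.pow 2).add hμs) hQ
    · exact ((contDiffOn_const.mul hμz).mul hd1).div (contDiffOn_const.sub hμs) h1μ
  have htrC : ContDiffOn ℝ ∞ tr I := hRv1.neg
  have hc0 : ∀ z ∈ I, c z ≠ 0 := fun z hz => by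
    simp only [hc_def]
    exact div_ne_zero (mul_ne_zero (h1μ z hz) (pow_ne_zero 2 (hd0 z hz))) (hQ z hz)
  /- STEP 2: the weighted height jets of the profiles, the jets of `k` and `α` -/
  obtain ⟨c1, c2, c3, hc1def, hc1C, Lc1, Lc2, Lc3⟩ := weighted_jets hI hcC hd1 hd0
  obtain ⟨g1, g2, g3, hg1def, -, Lg1, Lg2, Lg3⟩ := weighted_jets hI hgC hd1 hd0
  obtain ⟨t1, t2, t3, -, -, Lt1, Lt2, -⟩ := weighted_jets hI htrC hd1 hd0
  have hk1C : ContDiff ℝ 1 (deriv k) := hkC.deriv'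
  have Lk1 : ∀ s, HasDerivAt k (deriv k s) s := fun s => (hkC.differentiable (by norm_num) s).hasDerivAt
  have Lk2 : ∀ s, HasDerivAt (deriv k) (deriv (deriv k) s) s := fun s => (hk1C.differentiable (by norm_num) s).hasDerivAt
  have hk1cont : ∀ s ∈ S, ContinuousAt (deriv k) s := fun s _ => hk1C.continuous.continuousAt
  have hα1C : ContDiffOn ℝ 1 (deriv α) S := hα.deriv_of_isOpen hS (m := 1) (by norm_cast)
  have Lα2 : ∀ s ∈ S, HasDerivAt (deriv α) (deriv (deriv α) s) s := fun s hs =>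
    ((hα1C.differentiableOn (by norm_num)).differentiableAt (hS.mem_nhds hs)).hasDerivAt
  have hdd : ∀ z ∈ I, HasDerivAt d (deriv d z) z := fun z hz => ((hd.differentiableOn (by simp)).differentiableAt (hI.mem_nhds hz)).hasDerivAt
  /- STEP 3: (6b) on `S × I` -/
  have hform : ∀ s ∈ S, ∀ z ∈ I, H2 (s, z) = α s + g z - c z * k s / (1 - k s * d z) := by
    intro s hs z hz
    have hκ' : HasDerivAt κ (deriv κ z) z := ((hκ.differentiableOn (by simp)).differentiableAt (hI.mem_nhds hz)).hasDerivAt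
    have h := crossweb_velocity_on_sheet hrate hcont hmild hdiv hpol hμ3 hslabU hτ hτρ hΓ2 hpl hun hk hS hI hIρ hd hJ hν hT hs hz (hμ1 z hz) (hQ z hz)
      (fun z' hz' => hridge s hs z' hz') hκ' (hκ0 z hz) (hval s hs z hz) hσ (hkin s hs z hz) (hsplit s hs z hz)
    simpa [hH2, hW2, hc_def, hg_def] using h
  /- STEP 4: (1′)(2′) at every point, and the vertical derivative `∂₂θ(W) = R_v′` -/
  have hCR : ∀ s ∈ S, ∀ z ∈ I,
      deriv d z * (fderiv ℝ H2 (s, z) ((1 : ℝ), (0 : ℝ)) + k s * P2 (s, z)) = (1 - k s * d z) * fderiv ℝ P2 (s, z) ((0 : ℝ), (1 : ℝ)) ∧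
      (1 - k s * d z) * fderiv ℝ H2 (s, z) ((0 : ℝ), (1 : ℝ)) =
        deriv d z * ((1 - k s * d z) * (-(fderiv ℝ θ (W2 (s, z)) e2)) - fderiv ℝ P2 (s, z) ((1 : ℝ), (0 : ℝ)) + k s * H2 (s, z)) := by
    intro s hs z hz
    have h := sheet_CR_pair_on hrate hcont hmild hdiv hpol hslabU hτ hτρ hΓ2 hpl hun hk ((hd.differentiableOn (by simp)).differentiableAt (hI.mem_nhds hz))
      (hIρ z hz) (hν s hs z hz) (hT s hs z hz)
    simpa [hH2, hP2, hW2] using h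
  have hθz : ∀ s ∈ S, ∀ z ∈ I, fderiv ℝ θ (W2 (s, z)) e2 = deriv Rv z := by
    intro s hs z hz
    have hline : HasDerivAt (fun z' : ℝ => Γ s + d z' • rotJ (deriv Γ s) + z' • e2) (deriv d z • rotJ (deriv Γ s) + e2) z := by
      have h := (((hdd z hz).smul_const (rotJ (deriv Γ s))).const_add (Γ s)).fun_add ((hasDerivAt_id' z).smul_const e2)
      rw [one_smul] at h
      exact h
    have h1 : HasDerivAt (fun z' : ℝ => θ (Γ s + d z' • rotJ (deriv Γ s) + z' • e2)) (fderiv ℝ θ (W2 (s, z)) (deriv d z • rotJ (deriv Γ s) + e2)) z :=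
      (hθd _).hasFDerivAt.comp_hasDerivAt z hline
    have h2 : HasDerivAt (fun z' : ℝ => θ (Γ s + d z' • rotJ (deriv Γ s) + z' • e2)) (deriv Rv z) z := by
      have hev : (fun z' : ℝ => θ (Γ s + d z' • rotJ (deriv Γ s) + z' • e2)) =ᶠ[𝓝 z] Rv := by
        filter_upwards [hI.mem_nhds hz] with z' hz' using hval s hs z' hz'
      exact (((hRv.differentiableOn (by simp)).differentiableAt (hI.mem_nhds hz)).hasDerivAt).congr_of_eventuallyEq hev
    have h := h1.unique h2
    rw [map_add, map_smul, smul_eq_mul] at h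
    have hν0 : fderiv ℝ θ (W2 (s, z)) (rotJ (deriv Γ s)) = 0 := hν s hs z hz
    rw [hν0, mul_zero, zero_add] at h
    exact h
  /- STEP 5: the partial derivatives of the (6b)-form along `s` and `z` -/
  have hHs : ∀ s ∈ S, ∀ z ∈ I, fderiv ℝ H2 (s, z) ((1 : ℝ), (0 : ℝ)) = deriv α s - c z * deriv k s / (1 - k s * d z) ^ 2 := by
    intro s hs z hz
    have hdiff : DifferentiableAt ℝ H2 (s, z) := (hH2C.contDiffAt ((hS.prod hI).mem_nhds ⟨hs, hz⟩)).differentiableAt (by simp)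
    have h1 := hasDerivAt_slice_fst (p := (s, z)) hdiff
    have hJs : HasDerivAt (fun s' : ℝ => 1 - k s' * d z) (-(deriv k s * d z)) s := by
      simpa using ((Lk1 s).mul_const (d z)).const_sub 1
    have hq := hasDerivAt_div_pow 1 ((Lk1 s).const_mul (c z)) hJs rfl (hJ s hs z hz)
    have hαd : HasDerivAt α (deriv α s) s := ((hα.differentiableOn (by norm_num)).differentiableAt (hS.mem_nhds hs)).hasDerivAt
    have h2 := (hαd.add_const (g z)).sub hq
    have hev : (fun s' : ℝ => α s' + g z - c z * k s' / (1 - k s' * d z) ^ 1) =ᶠ[𝓝 s] fun s' => H2 (s', z) := by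
      filter_upwards [hS.mem_nhds hs] with s' hs'
      rw [pow_one, hform s' hs' z hz]
    have h := h1.unique (h2.congr_of_eventuallyEq hev.symm)
    rw [h]
    have hJ0 := hJ s hs z hz
    push_cast
    field_simp
    ring
  have hHz : ∀ s ∈ S, ∀ z ∈ I, fderiv ℝ H2 (s, z) ((0 : ℝ), (1 : ℝ)) =
      deriv d z * (g1 z - k s * c1 z / (1 - k s * d z) - k s ^ 2 * c z / (1 - k s * d z) ^ 2) := by
    intro s hs z hz
    have hdiff : DifferentiableAt ℝ H2 (s, z) := (hH2C.contDiffAt ((hS.prod hI).mem_nhds ⟨hs, hz⟩)).differentiableAt (by simp)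
    have h1 := hasDerivAt_slice_snd (p := (s, z)) hdiff
    have hJz : HasDerivAt (fun z' : ℝ => 1 - k s * d z') (-(k s * deriv d z)) z := by
      simpa using ((hdd z hz).const_mul (k s)).const_sub 1
    have hq := hasDerivAt_div_pow 1 ((Lc1 z hz).mul_const (k s)) hJz rfl (hJ s hs z hz)
    have h2 := ((Lg1 z hz).const_add (α s)).sub hq
    have hev : (fun z' : ℝ => α s + g z' - c z' * k s / (1 - k s * d z') ^ 1) =ᶠ[𝓝 z] fun z' => H2 (s, z') := by
      filter_upwards [hI.mem_nhds hz] with z' hz'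
      rw [pow_one, hform s hs z' hz']
    have h := h1.unique (h2.congr_of_eventuallyEq hev.symm)
    rw [h]
    have hJ0 := hJ s hs z hz
    push_cast
    field_simp
    ring
  /- STEP 6: the jets of `P` and the two identities (1′)(2′) in the currency of `tower_first_integral_height` -/
  set Pm : ℝ → ℝ → ℝ := fun s z => fderiv ℝ P2 (s, z) ((0 : ℝ), (1 : ℝ)) / deriv d z with hPm
  set Ps : ℝ → ℝ → ℝ := fun s z => fderiv ℝ P2 (s, z) ((1 : ℝ), (0 : ℝ)) with hPs
  set Psm : ℝ → ℝ → ℝ := fun s z => fderiv ℝ (fun q => fderiv ℝ P2 q ((1 : ℝ), (0 : ℝ))) (s, z) ((0 : ℝ), (1 : ℝ)) / deriv d z with hPsm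
  have hjets : ∀ s ∈ S, ∀ z ∈ I,
      HasDerivAt (fun s' => P2 (s', z)) (Ps s z) s ∧ HasDerivAt (fun z' => P2 (s, z')) (deriv d z * Pm s z) z ∧
      HasDerivAt (fun z' => Ps s z') (deriv d z * Psm s z) z ∧ HasDerivAt (fun s' => Pm s' z) (Psm s z) s :=
    fun s hs z hz => plane_jets hS hI hP2C hd0 hs hz
  have h1' : ∀ s ∈ S, ∀ z ∈ I, deriv α s - c z * deriv k s / (1 - k s * d z) ^ 2 = (1 - k s * d z) * Pm s z - k s * P2 (s, z) := by
    intro s hs z hz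
    have h := (hCR s hs z hz).1
    rw [hHs s hs z hz] at h
    have hd0z := hd0 z hz
    simp only [hPm]
    field_simp
    linear_combination h
  have h2' : ∀ s ∈ S, ∀ z ∈ I, Ps s z = -(1 - k s * d z) * (g1 z - k s * c1 z / (1 - k s * d z) - k s ^ 2 * c z / (1 - k s * d z) ^ 2)
      + k s * (α s + g z - c z * k s / (1 - k s * d z)) + (1 - k s * d z) * tr z := by
    intro s hs z hz
    have h := (hCR s hs z hz).2
    rw [hHz s hs z hz, hθz s hs z hz, hform s hs z hz] at h
    have hd0z := hd0 z hz
    have hJ0 := hJ s hs z hz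
    simp only [hPs, htr_def]
    have h' : (1 - k s * d z) * (g1 z - k s * c1 z / (1 - k s * d z) - k s ^ 2 * c z / (1 - k s * d z) ^ 2) =
        (1 - k s * d z) * (-deriv Rv z) - fderiv ℝ P2 (s, z) ((1 : ℝ), (0 : ℝ)) + k s * (α s + g z - c z * k s / (1 - k s * d z)) := by
      have := mul_left_cancel₀ hd0z (by linear_combination h : deriv d z * ((1 - k s * d z) * (g1 z - k s * c1 z / (1 - k s * d z) - k s ^ 2 * c z / (1 - k s * d z) ^ 2)) =
        deriv d z * ((1 - k s * d z) * (-deriv Rv z) - fderiv ℝ P2 (s, z) ((1 : ℝ), (0 : ℝ)) + k s * (α s + g z - c z * k s / (1 - k s * d z))))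
      exact this
    linear_combination h'
  /- STEP 7: the first integral (P) at the heights `m = d(z)` -/
  have hP : ∀ s ∈ S, ∀ z ∈ I,
      deriv (deriv k) s * (c1 z * (1 - k s * d z) ^ 2) + deriv k s ^ 2 * (3 * d z * c1 z * (1 - k s * d z) + 4 * c z)
        - (-2 * (k s * deriv (deriv α) s - deriv k s * deriv α s + k s ^ 3 * α s)) * (1 - k s * d z) ^ 3
        + (1 - k s * d z) ^ 3 *
          ((-(g3 z - t2 z)) + (((7 * g2 z + c3 z - 6 * t1 z) + 3 * d z * (g3 z - t2 z))) * k s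
            + (-2 * (5 * g1 z + 2 * c2 z - 3 * tr z) - 2 * d z * (7 * g2 z + c3 z - 6 * t1 z) - 3 * d z ^ 2 * (g3 z - t2 z)) * k s ^ 2
            + (2 * (g z + c1 z) + 2 * d z * (5 * g1 z + 2 * c2 z - 3 * tr z) + d z ^ 2 * (7 * g2 z + c3 z - 6 * t1 z) + d z ^ 3 * (g3 z - t2 z)) * k s ^ 3) = 0 := by
    intro s hs z hz
    have h := tower_first_integral_height (S := S) (I := I) (k := k) (k1 := deriv k) (k2 := deriv (deriv k)) (α := α) (α1 := deriv α) (α2 := deriv (deriv α))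
      (d := d) (d1 := deriv d) (c := c) (c1 := c1) (c2 := c2) (c3 := c3) (g := g) (g1 := g1) (g2 := g2) (g3 := g3) (t := tr) (t1 := t1) (t2 := t2)
      (P := fun s z => P2 (s, z)) (Ps := Ps) (Pm := Pm) (Psm := Psm)
      hS hI (fun s _ => Lk1 s) (fun s _ => Lk2 s) Lα2 hdd hd0 Lc1 Lc2 Lc3 Lg1 Lg2 Lg3 Lt1 Lt2 hJ
      (fun s hs z hz => (hjets s hs z hz).1) (fun s hs z hz => (hjets s hs z hz).2.1) (fun s hs z hz => (hjets s hs z hz).2.2.1)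
      (fun s hs z hz => (hjets s hs z hz).2.2.2) h1' h2' hs hz
    linear_combination h
  /- STEP 8: infinitely many heights, and the pole argument -/
  have hWinf : ((d '' I) \ {0}).Infinite := by
    obtain ⟨z₀, hz₀⟩ := hIne
    obtain ⟨ε, hε, hball⟩ := Metric.isOpen_iff.1 hI z₀ hz₀
    have hsub : Ioo (z₀ - ε) (z₀ + ε) ⊆ I := fun z hz => hball (by rw [Metric.mem_ball, Real.dist_eq, abs_lt]; constructor <;> linarith [hz.1, hz.2])
    have hinj : InjOn d (Ioo (z₀ - ε) (z₀ + ε)) := by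
      intro a ha b hb hab
      by_contra hne
      have hIcc : ∀ {x y : ℝ}, x ∈ Ioo (z₀ - ε) (z₀ + ε) → y ∈ Ioo (z₀ - ε) (z₀ + ε) → ∀ u ∈ Icc x y, u ∈ I := fun hx hy u hu =>
        hsub ⟨by linarith [hx.1, hu.1], by linarith [hy.2, hu.2]⟩
      rcases lt_or_gt_of_ne hne with hlt | hlt
      · obtain ⟨x, hx, hx0⟩ := exists_hasDerivAt_eq_zero hlt (fun u hu => (hdd u (hIcc ha hb u hu)).continuousAt.continuousWithinAt) hab
          (fun u hu => hdd u (hIcc ha hb u (Ioo_subset_Icc_self hu)))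
        exact hd0 x (hIcc ha hb x (Ioo_subset_Icc_self hx)) hx0
      · obtain ⟨x, hx, hx0⟩ := exists_hasDerivAt_eq_zero hlt (fun u hu => (hdd u (hIcc hb ha u hu)).continuousAt.continuousWithinAt) hab.symm
          (fun u hu => hdd u (hIcc hb ha u (Ioo_subset_Icc_self hu)))
        exact hd0 x (hIcc hb ha x (Ioo_subset_Icc_self hx)) hx0
    have hinf : (d '' Ioo (z₀ - ε) (z₀ + ε)).Infinite := (Ioo_infinite (by linarith)).image hinj
    exact (hinf.mono (image_mono hsub)).sdiff (Set.finite_singleton 0)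
  exact curvature_deriv_eq_zero_of_first_integral (k := k) (k₁ := deriv k) (k₂ := fun s => deriv (deriv k) s) (d := d) (c := c) (c₁ := c1)
    (e₀ := fun z => -(g3 z - t2 z)) (e₁ := fun z => (7 * g2 z + c3 z - 6 * t1 z) + 3 * d z * (g3 z - t2 z))
    (e₂ := fun z => -2 * (5 * g1 z + 2 * c2 z - 3 * tr z) - 2 * d z * (7 * g2 z + c3 z - 6 * t1 z) - 3 * d z ^ 2 * (g3 z - t2 z))
    (e₃ := fun z => 2 * (g z + c1 z) + 2 * d z * (5 * g1 z + 2 * c2 z - 3 * tr z) + d z ^ 2 * (7 * g2 z + c3 z - 6 * t1 z) + d z ^ 3 * (g3 z - t2 z))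
    (Zs := fun s => -2 * (k s * deriv (deriv α) s - deriv k s * deriv α s + k s ^ 3 * α s))
    hS hs₀ (fun s _ => Lk1 s) hk1cont hWinf hc0 (fun s hs z hz => by
      have h := hP s hs z hz
      linear_combination h)

end Summit.NavierStokesRegularity.NavierStokesRegularity.Theorems.PoloidalWindowDoorLrcModEntireCurvedTowerKill

end
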